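import Summits.ABC.IUTFork.Cor312VolumesPadicLattice
import HarnessLib

/-!
# [IUTchIII] Corollary 3.12, statement — SUMMAND-WISE SCALED log-shell lattices `Π_{v⃗} c(v⃗)·I_{v⃗}` of the
# real prime packets: (Ind2) fixes them, (Ind1) RE-INDEXES the scalars, the orbit is the capsule orbit

Record-only file (D-0012) of the abc-iut cell (Cor. 3.12 sub-crew, seat abc-iut-c312-5, gen 4; continues gen 3's
`Cor312VolumesPadicLattice` — the CONSTANT-scalar lattices `e⁻¹(Π_{v⃗} c·I_{v⃗})` — for the residual named by
abc-iut-w5-d060's `Cor312HullGluedStable` p424693 / `Cor312HullGluedDHVol` p425664: ONE-SET STABILITY `hst` of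
print's `^{n,∘}𝒰_{j,v_ℚ}` at the packets where the Θ-boxes are NOT the unit polydisc); TAKES NO SIDE.
[IUTchIII] Thm. 3.11 (i) (Ind1) (kurims `paper:url-4b091feeb646` p. 154 l. 48–53) acts on the `(j+1)`-tensor
packet through "the automorphisms of the procession of `𝒟^⊢`-prime-strips", i.e. (c312-1 `LogShells.Ind1`) one
permutation `σ` of the capsule `S^±_{j+1}` for all `v_ℚ`; Dupuy–Hilado (arXiv:2004.13228 §4.7) make it act
"simultaneously" on the tuples `v⃗ = (v_0, …, v_j)`. A Θ-box read off ideles through the LAST tensor factor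
(Dupuy–Hilado §3.7/§3.9, abc-iut-c312-3 `sharpBoxDH`: `ι_j(t_{Θ,j,v_j})·(R_I)^∼`) is therefore NOT (Ind1)-symmetric:
its scalar at `v⃗` depends on `v_j` only. THIS FILE supplies the lattice algebra for such boxes, for ANY `p`-adic
presentation `P` of c312-1's log-shell carriers (`Cor312VolumesPadicSummands`) and ANY scalar function
`c : (S^±_{j+1} → {v | v_ℚ}) → ℚ_p` on the summands:

* `summandLatticeS c = Π_{v⃗} c(v⃗)·I_{v⃗}` and its preimage `latticePkS c = e⁻¹(Π_{v⃗} c(v⃗)·I_{v⃗})`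
  (`latticePkS (fun _ => c)` IS gen 3's `latticePk c`, `latticePkS_const`);
* (Ind1): `permute σ` maps `latticePkS c` ONTO `latticePkS (v⃗ ↦ c(v⃗ ∘ σ))` (`permute_image_latticePkS` — the
  comparison intertwines `permute σ` with the summand permutation `permΨ σ`, gen 3 `comparison_permute`, and
  `perm_σ(c·I_{v⃗∘σ}) = c·I_{v⃗}`, gen 3 `permX_image_smul_logShell`);
* (Ind2) and the strip part of (Ind1): every factor-and-summand-wise family FIXES `latticePkS c` for EVERY `c`
  (`ism_image_latticePkS`, `strip_image_latticePkS` — Dupuy–Hilado §4.9 "the Ind2 indeterminacies also preserve this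
  lattice", summand by summand);
* hence every `Φ` in c312-7's indeterminacy group `⟨Ind1Family ∪ Ind2Family⟩` carries `latticePkS c` onto
  `latticePkS (v⃗ ↦ c(v⃗ ∘ σ_Φ))` for ONE permutation `σ_Φ` of the capsule, the same for all `c`
  (`exists_perm_image_latticePkS_of_mem_closure`); in particular a CAPSULE-SYMMETRIC scalar function gives a
  lattice fixed by the whole group (`image_latticePkS_of_mem_closure_of_symm`);
* conversely every permutation IS realised: the family `permFamily j σ` (permute by `σ` at label `j`, identity
  elsewhere) lies in `Ind1Family` (`permFamily_mem_Ind1Family`), so the orbit of `latticePkS c` under the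
  indeterminacy group is EXACTLY `{latticePkS (v⃗ ↦ c(v⃗ ∘ σ)) | σ ∈ Perm(S^±_{j+1})}`
  (`image_latticePkS_mem_orbit_iff`).
[claim: Mochizuki2012, status: disputed] for the quoted actions; [cite: DupuyHilado2025, §3.9, §4.7, §4.9].
Deliberately NOT here: the identification with hull-sets at unramified `p`, Θ-boxes, the `Cor312.Setting`
(companion `Cor312HullStableDHVol` over c312-5's `Real.settingDHVol`), any judgement.
-/

noncomputable section

open Set Function
open scoped Pointwise

namespace Summit.ABC

namespace IUTFork

namespace Cor312Vol

open Thm311 Literature.IUT.LogThetaLattice Literature.IUT.LogVolume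

variable {T : ThetaIndex}

/-- Pure set algebra: if `e ∘ Φ = Ψ ∘ e` with `Φ` onto and `Ψ` one-to-one mapping `Λ` onto `Λ'`, then `Φ` maps
`e⁻¹(Λ)` onto `e⁻¹(Λ')` (two-lattice form of gen 3's `image_preimage_eq_of_semiconj`). [folklore] -/
theorem image_preimage_eq_of_semiconj' {α β : Type*} {e : α → β} {Φ : α → α} (hΦ : Function.Surjective Φ)
    {Ψ : β → β} (hΨ : Function.Injective Ψ) (h : ∀ x, e (Φ x) = Ψ (e x)) {Λ Λ' : Set β} (hΛ : Ψ '' Λ = Λ') :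
    Φ '' (e ⁻¹' Λ) = e ⁻¹' Λ' := by
  apply Set.Subset.antisymm
  · rintro _ ⟨x, hx, rfl⟩
    show e (Φ x) ∈ Λ'
    rw [h, ← hΛ]
    exact ⟨e x, hx, rfl⟩
  · intro y hy
    obtain ⟨x, rfl⟩ := hΦ y
    refine ⟨x, ?_, rfl⟩
    have hx : Ψ (e x) ∈ Ψ '' Λ := by rw [hΛ, ← h]; exact hy
    obtain ⟨z, hz, hzx⟩ := hx
    show e x ∈ Λ
    rwa [← hΨ hzx]

namespace PadicPresentation

variable {L : LogShells T} {vQ : T.VQ} {p : ℕ} [hp : Fact p.Prime] (P : PadicPresentation L vQ p)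

/-! ## 1. The summand-wise scaled lattices `Π_{v⃗} c(v⃗)·I_{v⃗}` -/

section Lattice

variable {j : T.Label}

/-- **The summand-wise scaled log-shell lattice `Π_{v⃗} c(v⃗)·I_{v⃗}`** of the real `(j+1)`-packet over `p`, for a
scalar function `c` on the summands (the boxes `ι_j(t_{Θ,j,v_j})·(R_I)^∼` of Dupuy–Hilado §3.9 have this shape at an
unramified `p`, with `‖c(v⃗)‖ = ‖t_{Θ,j,v_j}‖`). [cite: DupuyHilado2025, §3.9] -/
def summandLatticeS (j : T.Label) (c : (T.Caps j → T.Fibre vQ) → ℚ_[p]) :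
    Set (∀ e : T.Caps j → T.Fibre vQ, P.X e) :=
  Set.pi univ fun e => c e • logShell p (P.kk e)

/-- Its preimage `e⁻¹(Π_{v⃗} c(v⃗)·I_{v⃗})` in the algebraic packet `𝓘^ℚ(^{S^±_{j+1}};𝒟^⊢_{v_ℚ})`.
[cite: DupuyHilado2025, §4 (intro)] -/
def latticePkS (j : T.Label) (c : (T.Caps j → T.Fibre vQ) → ℚ_[p]) : Set (L.Packet j vQ) :=
  P.comparison j ⁻¹' P.summandLatticeS j c

/-- Membership in `Π_{v⃗} c(v⃗)·I_{v⃗}`. [folklore] -/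
theorem mem_summandLatticeS_iff (c : (T.Caps j → T.Fibre vQ) → ℚ_[p]) (y : ∀ e : T.Caps j → T.Fibre vQ, P.X e) :
    y ∈ P.summandLatticeS j c ↔ ∀ e, y e ∈ c e • logShell p (P.kk e) := by
  simp [summandLatticeS]

/-- The constant scalar function gives gen 3's lattice: `latticePkS (v⃗ ↦ c) = latticePk c`. [folklore] -/
theorem latticePkS_const (c : ℚ_[p]) : P.latticePkS j (fun _ => c) = P.latticePk j c := rfl

/-- Re-indexing by the identity permutation changes nothing. [folklore] -/
theorem latticePkS_reindex_one (c : (T.Caps j → T.Fibre vQ) → ℚ_[p]) :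
    P.latticePkS j (fun e => c (e ∘ ⇑(1 : Equiv.Perm (T.Caps j)))) = P.latticePkS j c := by
  simp only [Equiv.Perm.coe_one, Function.comp_id]

/-- Re-indexing twice is re-indexing by the product. [folklore] -/
theorem reindex_reindex (c : (T.Caps j → T.Fibre vQ) → ℚ_[p]) (σ₁ σ₂ : Equiv.Perm (T.Caps j)) :
    (fun e : T.Caps j → T.Fibre vQ => (fun e' : T.Caps j → T.Fibre vQ => c (e' ∘ ⇑σ₂)) (e ∘ ⇑σ₁)) =
      fun e => c (e ∘ ⇑(σ₁ * σ₂)) := by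
  funext e
  simp only [Equiv.Perm.coe_mul]
  rfl

/-- Re-indexing by `σ⁻¹` then `σ` changes nothing. [folklore] -/
theorem reindex_inv_reindex (c : (T.Caps j → T.Fibre vQ) → ℚ_[p]) (σ : Equiv.Perm (T.Caps j)) :
    (fun e : T.Caps j → T.Fibre vQ => (fun e' : T.Caps j → T.Fibre vQ => c (e' ∘ ⇑σ⁻¹)) (e ∘ ⇑σ)) = c := by
  funext e
  show c ((e ∘ ⇑σ) ∘ ⇑σ⁻¹) = c e
  congr 1
  funext a
  simp

/-- A capsule-SYMMETRIC scalar function is unchanged by re-indexing. [folklore] -/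
theorem reindex_eq_of_symm {c : (T.Caps j → T.Fibre vQ) → ℚ_[p]} (hc : ∀ (σ : Equiv.Perm (T.Caps j)) e, c (e ∘ ⇑σ) = c e)
    (σ : Equiv.Perm (T.Caps j)) : (fun e : T.Caps j → T.Fibre vQ => c (e ∘ ⇑σ)) = c :=
  funext fun e => hc σ e

/-! ## 2. (Ind1) re-indexes the scalars; (Ind2) fixes every scaled lattice -/

/-- **The summand permutation `permΨ σ` maps `Π_{v⃗} c(v⃗)·I_{v⃗}` onto `Π_{v⃗} c(v⃗∘σ)·I_{v⃗}`**: `perm_σ` carries the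
`v⃗∘σ`-block `c(v⃗∘σ)·I_{v⃗∘σ}` to `c(v⃗∘σ)·I_{v⃗}` (gen 3 `permX_image_smul_logShell`). [cite: DupuyHilado2025, §4.7] -/
theorem permΨ_image_summandLatticeS (σ : Equiv.Perm (T.Caps j)) (c : (T.Caps j → T.Fibre vQ) → ℚ_[p]) :
    P.permΨ σ '' P.summandLatticeS j c = P.summandLatticeS j (fun e => c (e ∘ ⇑σ)) := by
  unfold summandLatticeS
  rw [permΨ_image_pi]
  exact congrArg (Set.pi univ) (funext fun e => P.permX_image_smul_logShell σ e (c (e ∘ ⇑σ)))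

/-- **Summandwise `⊗_a g'_a` families FIX `Π_{v⃗} c(v⃗)·I_{v⃗}` for EVERY scalar function** (`ℚ_p`-linear `g'_{a,v}`
preserving `log_p(𝒪^×_{K_v})`; Dupuy–Hilado §4.9). [cite: DupuyHilado2025, §4.9] -/
theorem congr_image_summandLatticeS (g' : T.Caps j → ∀ v : T.Fibre vQ, P.k v ≃ₗ[ℚ_[p]] P.k v)
    (hlog : ∀ i v, g' i v '' logUnits (P.k v) = logUnits (P.k v)) (c : (T.Caps j → T.Fibre vQ) → ℚ_[p]) :
    (fun (y : ∀ e : T.Caps j → T.Fibre vQ, P.X e) e =>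
        (PiTensorProduct.congr fun a => g' a (e a) : P.X e ≃ₗ[ℚ_[p]] P.X e) (y e)) '' P.summandLatticeS j c =
      P.summandLatticeS j c := by
  unfold summandLatticeS
  have h := Set.piMap_image_univ_pi
    (fun e : T.Caps j → T.Fibre vQ => ⇑(PiTensorProduct.congr fun a => g' a (e a) : P.X e ≃ₗ[ℚ_[p]] P.X e))
    (fun e => c e • logShell p (P.kk e))
  rw [show (fun (y : ∀ e : T.Caps j → T.Fibre vQ, P.X e) e =>
      (PiTensorProduct.congr fun a => g' a (e a) : P.X e ≃ₗ[ℚ_[p]] P.X e) (y e)) =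
      Pi.map (fun e => ⇑(PiTensorProduct.congr fun a => g' a (e a) : P.X e ≃ₗ[ℚ_[p]] P.X e)) from rfl, h]
  exact congrArg (Set.pi univ) (funext fun e =>
    P.image_smul_logShell_of_mem_indTwo (P.congr_mem_indTwo e _ fun a => hlog a (e a)) (c e))

/-- **`permute σ` maps `e⁻¹(Π_{v⃗} c(v⃗)·I_{v⃗})` onto `e⁻¹(Π_{v⃗} c(v⃗∘σ)·I_{v⃗})`** — the (Ind1) permutation
RE-INDEXES a summand-wise scaled lattice. [cite: DupuyHilado2025, §4.7] -/
theorem permute_image_latticePkS (σ : Equiv.Perm (T.Caps j)) (c : (T.Caps j → T.Fibre vQ) → ℚ_[p]) :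
    L.permute j vQ σ '' P.latticePkS j c = P.latticePkS j (fun e => c (e ∘ ⇑σ)) :=
  image_preimage_eq_of_semiconj' (L.permute j vQ σ).surjective (P.permΨ σ).injective (P.comparison_permute σ)
    (P.permΨ_image_summandLatticeS σ c)

/-- A factor-and-summand-wise family intertwined with shell-preserving `ℚ_p`-linear maps FIXES every
`e⁻¹(Π_{v⃗} c(v⃗)·I_{v⃗})`. [cite: DupuyHilado2025, §4.9] -/
theorem factorwise_image_latticePkS (g : T.Caps j → ∀ v : T.Fibre vQ, L.carrier v.1 ≃ₗ[ℚ] L.carrier v.1)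
    (g' : T.Caps j → ∀ v : T.Fibre vQ, P.k v ≃ₗ[ℚ_[p]] P.k v)
    (hg' : ∀ i v x, P.φ v (g i v x) = g' i v (P.φ v x))
    (hlog : ∀ i v, g' i v '' logUnits (P.k v) = logUnits (P.k v)) (c : (T.Caps j → T.Fibre vQ) → ℚ_[p]) :
    L.factorwise j vQ (fun i => L.summandwise vQ (g i)) '' P.latticePkS j c = P.latticePkS j c := by
  refine image_preimage_eq_of_semiconj' (LinearEquiv.surjective _) (fun y y' h => ?_)
    (P.comparison_factorwise g g' hg') (P.congr_image_summandLatticeS g' hlog c)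
  funext e
  exact (PiTensorProduct.congr fun a => g' a (e a) : P.X e ≃ₗ[ℚ_[p]] P.X e).injective (congrFun h e)

/-- **(Ind2) fixes every `e⁻¹(Π_{v⃗} c(v⃗)·I_{v⃗})`**. [cite: DupuyHilado2025, §4.9] -/
theorem ism_image_latticePkS (g : T.Caps j → ∀ v : T.Fibre vQ, L.carrier v.1 ≃ₗ[ℚ] L.carrier v.1)
    (hg : ∀ i v, g i v ∈ L.ism v.1) (c : (T.Caps j → T.Fibre vQ) → ℚ_[p]) :
    L.factorwise j vQ (fun i => L.summandwise vQ (g i)) '' P.latticePkS j c = P.latticePkS j c := by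
  choose g' hg' using fun i v => P.ism_linear v (g i v) (hg i v)
  exact P.factorwise_image_latticePkS g g' hg'
    (fun i v => P.image_logUnits_eq (hg' i v) (P.ism_shell v _ (hg i v))) c

/-- **The strip part of (Ind1) fixes every `e⁻¹(Π_{v⃗} c(v⃗)·I_{v⃗})`**. [cite: DupuyHilado2025, §4.7] -/
theorem strip_image_latticePkS (g : T.Caps j → ∀ v : T.Fibre vQ, L.carrier v.1 ≃ₗ[ℚ] L.carrier v.1)
    (hg : ∀ i v, g i v ∈ L.stripAut v.1) (c : (T.Caps j → T.Fibre vQ) → ℚ_[p]) :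
    L.factorwise j vQ (fun i => L.summandwise vQ (g i)) '' P.latticePkS j c = P.latticePkS j c := by
  choose g' hg' using fun i v => P.strip_linear v (g i v) (hg i v)
  exact P.factorwise_image_latticePkS g g' hg'
    (fun i v => P.image_logUnits_eq (hg' i v) (P.strip_shell v _ (hg i v))) c

/-! ## 3. Every element of the indeterminacy group re-indexes by ONE permutation -/

/-- **Every (Ind1)- or (Ind2)-FAMILY re-indexes the scaled lattices by one capsule permutation** (the identity for
(Ind2)), the same for every scalar function. [cite: DupuyHilado2025, §4.7, §4.9] -/
theorem exists_perm_image_latticePkS_of_mem_family {Φ : L.PacketAut} (hΦ : Φ ∈ L.Ind1Family ∪ L.Ind2Family)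
    (j : T.Label) :
    ∃ σ : Equiv.Perm (T.Caps j), ∀ c : (T.Caps j → T.Fibre vQ) → ℚ_[p],
      Φ j vQ '' P.latticePkS j c = P.latticePkS j (fun e => c (e ∘ ⇑σ)) := by
  rcases hΦ with hΦ | hΦ
  · obtain ⟨σ, h, hh, hΦj⟩ := hΦ j
    refine ⟨σ, fun c => ?_⟩
    have hΦj' : Φ j vQ = (L.permute j vQ σ).trans
        (L.factorwise j vQ fun i => L.summandwise vQ fun v : T.Fibre vQ => h i v.1) := hΦj vQ
    have hcomp : (⇑(Φ j vQ) : L.Packet j vQ → L.Packet j vQ) =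
        ⇑(L.factorwise j vQ fun i => L.summandwise vQ fun v : T.Fibre vQ => h i v.1) ∘ ⇑(L.permute j vQ σ) := by
      rw [hΦj']; rfl
    rw [hcomp, Set.image_comp, P.permute_image_latticePkS σ c]
    exact P.strip_image_latticePkS (fun i v => h i v.1) (fun i v => hh i v.1) _
  · refine ⟨1, fun c => ?_⟩
    obtain ⟨g, hg, hΦj⟩ := hΦ j vQ
    rw [hΦj, P.latticePkS_reindex_one]
    exact P.ism_image_latticePkS g hg c

/-- **Every element of `⟨Ind1Family ∪ Ind2Family⟩` (c312-7's `Setting.indGroup`) re-indexes the scaled lattices by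
ONE capsule permutation**, the same for every scalar function (closure induction: products multiply the
permutations, inverses invert them). [cite: DupuyHilado2025, §4 (intro)] -/
theorem exists_perm_image_latticePkS_of_mem_closure {Φ : L.PacketAut}
    (hΦ : Φ ∈ Subgroup.closure (L.Ind1Family ∪ L.Ind2Family)) (j : T.Label) :
    ∃ σ : Equiv.Perm (T.Caps j), ∀ c : (T.Caps j → T.Fibre vQ) → ℚ_[p],
      Φ j vQ '' P.latticePkS j c = P.latticePkS j (fun e => c (e ∘ ⇑σ)) := by
  induction hΦ using Subgroup.closure_induction with
  | mem Ψ hΨ => exact P.exists_perm_image_latticePkS_of_mem_family hΨ j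
  | one => exact ⟨1, fun c => by rw [P.latticePkS_reindex_one]; simp⟩
  | mul Ψ₁ Ψ₂ _ _ ih₁ ih₂ =>
    obtain ⟨σ₁, h₁⟩ := ih₁
    obtain ⟨σ₂, h₂⟩ := ih₂
    refine ⟨σ₁ * σ₂, fun c => ?_⟩
    have hcomp : ⇑((Ψ₁ * Ψ₂) j vQ) = ⇑(Ψ₁ j vQ) ∘ ⇑(Ψ₂ j vQ) := by
      funext x
      rfl
    rw [hcomp, Set.image_comp, h₂, h₁, reindex_reindex]
  | inv Ψ _ ih =>
    obtain ⟨σ, h⟩ := ih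
    refine ⟨σ⁻¹, fun c => ?_⟩
    change ⇑((Ψ j vQ).symm) '' P.latticePkS j c = _
    have key := h (fun e => c (e ∘ ⇑σ⁻¹))
    rw [reindex_inv_reindex] at key
    conv_lhs => rw [← key]
    rw [Set.image_image]
    simp only [LinearEquiv.symm_apply_apply, Set.image_id']

/-- **A capsule-SYMMETRIC scaled lattice is fixed by the whole indeterminacy group** (e.g. the constant ones of
gen 3, `image_latticePk_of_mem_closure`). [cite: DupuyHilado2025, §4 (intro)] -/
theorem image_latticePkS_of_mem_closure_of_symm {Φ : L.PacketAut}
    (hΦ : Φ ∈ Subgroup.closure (L.Ind1Family ∪ L.Ind2Family)) (j : T.Label)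
    {c : (T.Caps j → T.Fibre vQ) → ℚ_[p]} (hc : ∀ (σ : Equiv.Perm (T.Caps j)) e, c (e ∘ ⇑σ) = c e) :
    Φ j vQ '' P.latticePkS j c = P.latticePkS j c := by
  obtain ⟨σ, h⟩ := P.exists_perm_image_latticePkS_of_mem_closure hΦ j
  rw [h c, reindex_eq_of_symm hc]

/-- In particular every (Ind1)/(Ind2)-FAMILY fixes a capsule-symmetric scaled lattice (the hypothesis `hW` of
c312-7's `sUnion_possibleImages_subset`). [cite: DupuyHilado2025, §4 (intro)] -/
theorem family_image_latticePkS_of_symm {Φ : L.PacketAut} (hΦ : Φ ∈ L.Ind1Family ∪ L.Ind2Family) (j : T.Label)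
    {c : (T.Caps j → T.Fibre vQ) → ℚ_[p]} (hc : ∀ (σ : Equiv.Perm (T.Caps j)) e, c (e ∘ ⇑σ) = c e) :
    Φ j vQ '' P.latticePkS j c = P.latticePkS j c :=
  P.image_latticePkS_of_mem_closure_of_symm (Subgroup.subset_closure hΦ) j hc

end Lattice

end PadicPresentation

end Cor312Vol

/-! ## 4. Every capsule permutation is an (Ind1)-family -/

namespace Thm311

namespace LogShells

variable {T : ThetaIndex} (L : LogShells T)

open Classical in
/-- **The (Ind1)-family permuting the capsule at ONE label**: `permute σ` at label `j` (every `v_ℚ`), the identity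
at the other labels, no strip-automorphism ([IUTchIII] Thm. 3.11 (i) (Ind1): an automorphism of the procession
may permute each capsule). [claim: Mochizuki2012, status: disputed] -/
def permFamily (j : T.Label) (σ : Equiv.Perm (T.Caps j)) : L.PacketAut :=
  Function.update (fun j' vQ => LinearEquiv.refl ℚ (L.Packet j' vQ)) j (fun vQ => L.permute j vQ σ)

/-- At label `j` the family is `permute σ`. [folklore] -/
theorem permFamily_apply_self (j : T.Label) (σ : Equiv.Perm (T.Caps j)) (vQ : T.VQ) :
    L.permFamily j σ j vQ = L.permute j vQ σ := by
  unfold permFamily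
  rw [Function.update_self]

/-- At the other labels the family is the identity. [folklore] -/
theorem permFamily_apply_of_ne {j j' : T.Label} (h : j' ≠ j) (σ : Equiv.Perm (T.Caps j)) (vQ : T.VQ) :
    L.permFamily j σ j' vQ = LinearEquiv.refl ℚ (L.Packet j' vQ) := by
  unfold permFamily
  rw [Function.update_of_ne h]

/-- **`permFamily j σ` IS an (Ind1)-family** (strip part trivial: `one_mem_stripAut`). [claim: Mochizuki2012, status: disputed] -/
theorem permFamily_mem_Ind1Family (j : T.Label) (σ : Equiv.Perm (T.Caps j)) : L.permFamily j σ ∈ L.Ind1Family := by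
  intro j'
  by_cases h : j' = j
  · subst h
    refine ⟨σ, fun _ v => LinearEquiv.refl ℚ (L.carrier v), fun _ v => L.one_mem_stripAut v, fun vQ => ?_⟩
    show L.permFamily j' σ j' vQ = _
    rw [permFamily_apply_self, summandwise_refl_family, factorwise_refl]
    rfl
  · have hΦ : (fun vQ => L.permFamily j σ j' vQ) = fun vQ => LinearEquiv.refl ℚ (L.Packet j' vQ) :=
      funext fun vQ => L.permFamily_apply_of_ne h σ vQ
    show (fun vQ => L.permFamily j σ j' vQ) ∈ L.Ind1 j'
    rw [hΦ]
    exact L.refl_mem_Ind1 j'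

/-- … hence lies in the indeterminacy group `⟨Ind1Family ∪ Ind2Family⟩`. [folklore] -/
theorem permFamily_mem_closure (j : T.Label) (σ : Equiv.Perm (T.Caps j)) :
    L.permFamily j σ ∈ Subgroup.closure (L.Ind1Family ∪ L.Ind2Family) :=
  Subgroup.subset_closure (Or.inl (L.permFamily_mem_Ind1Family j σ))

end LogShells

end Thm311

namespace Cor312Vol

namespace PadicPresentation

open Thm311 Literature.IUT.LogThetaLattice Literature.IUT.LogVolume

variable {T : ThetaIndex} {L : LogShells T} {vQ : T.VQ} {p : ℕ} [hp : Fact p.Prime] (P : PadicPresentation L vQ p)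
  {j : T.Label}

/-- **The orbit of `e⁻¹(Π_{v⃗} c(v⃗)·I_{v⃗})` under the indeterminacy group is EXACTLY the set of its capsule
re-indexings.** [cite: DupuyHilado2025, §4.7, §4.9] -/
theorem image_latticePkS_mem_orbit_iff (c : (T.Caps j → T.Fibre vQ) → ℚ_[p]) (U : Set (L.Packet j vQ)) :
    (∃ Φ ∈ Subgroup.closure (L.Ind1Family ∪ L.Ind2Family), U = Φ j vQ '' P.latticePkS j c) ↔
      ∃ σ : Equiv.Perm (T.Caps j), U = P.latticePkS j (fun e => c (e ∘ ⇑σ)) := by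
  constructor
  · rintro ⟨Φ, hΦ, rfl⟩
    obtain ⟨σ, h⟩ := P.exists_perm_image_latticePkS_of_mem_closure hΦ j
    exact ⟨σ, h c⟩
  · rintro ⟨σ, rfl⟩
    refine ⟨L.permFamily j σ, L.permFamily_mem_closure j σ, ?_⟩
    rw [L.permFamily_apply_self, P.permute_image_latticePkS]

/-- The union of the orbit is the union of the re-indexings. [cite: DupuyHilado2025, §4.7, §4.9] -/
theorem sUnion_orbit_latticePkS (c : (T.Caps j → T.Fibre vQ) → ℚ_[p]) :
    ⋃₀ {U | ∃ Φ ∈ Subgroup.closure (L.Ind1Family ∪ L.Ind2Family), U = Φ j vQ '' P.latticePkS j c} =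
      ⋃ σ : Equiv.Perm (T.Caps j), P.latticePkS j (fun e => c (e ∘ ⇑σ)) := by
  ext x
  simp only [Set.mem_sUnion, Set.mem_setOf_eq, Set.mem_iUnion]
  constructor
  · rintro ⟨U, hU, hx⟩
    obtain ⟨σ, rfl⟩ := (P.image_latticePkS_mem_orbit_iff c U).1 hU
    exact ⟨σ, hx⟩
  · rintro ⟨σ, hx⟩
    exact ⟨_, (P.image_latticePkS_mem_orbit_iff c _).2 ⟨σ, rfl⟩, hx⟩

end PadicPresentation

end Cor312Vol

end IUTFork

end Summit.ABC

end
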